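/-
Copyright (c) 2026 the pub-hodgecm-mathlib formalisation cell (harness21).  Prover seat hodgecm-mathlib-K2E1-p10 (g2), Track B ∕ K2-LIT (build stream 29), h413 = `stmt-HodgeConjecture-24833`,
route of record `HCCMUnconditional`, campaign «5Res (b) BL-2(χ,τ)»; dealer K2E1-plan (g7) deal (135) 2026-09-04T11:31:28Z («`K2E1ChiConstantTermColumnsIndependentU2` = the payer of 12b∕X1_χ's
NEW letter `hLinj` — `L z` injective on the Godement part = linear independence in `HN` of the columns `[φ′_j H^{1−z}]` for a basis `φ′_j` of `V′ = chiSectionSpace χʷ K′ ω′`»).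
-/
import Summits.HodgeConjecture.HodgeConjecture.Theorems.K2E1BLXSystemPackageFinDimU          -- ★ row 11b (this seat): `injective_sum_proj_smulRight_iff`, `sum_proj_smulRight_apply`
import Summits.HodgeConjecture.HodgeConjecture.Theorems.K2E1ChiFlatSectionHNHolomorphicU2     -- ★ (K2E1-p15): `zFun_flatSectionU`; brings ★ `measurable_zFun_of_measurable`, `borelQuotHeight_pos`, `flatSectionU`
import Summits.HodgeConjecture.HodgeConjecture.Theorems.K2E1BLShiftBoundU2                    -- ★ P3-B′: `ae_weightedTruncMeasure_iff`; brings ★ `K2E1BLIotaUnfoldingU` (`B(F)♯` discrete, `mem_ratBorelSubgroup_of_mem_map`)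
import Summits.HodgeConjecture.HodgeConjecture.Theorems.K2E1CharacterEisensteinU2Defs         -- ★ p859441 (K2-defs1): `IsChiSection` (+ `borel_mul`, `toAdelic_mul`, `add`, `smul`, `zero`)
import Summits.HodgeConjecture.HodgeConjecture.Theorems.K2E1BorelCosetsDictionary             -- ★ (K2E1-p08): `forall_arithmeticBorel_iff` (the two spellings of «left-`B(F)`-invariant»)
import Summits.HodgeConjecture.HodgeConjecture.Theorems.K2E1BLHeightCosetsU2                  -- ★ (K2E3-p12): `exists_torus_posRealIdele_two` — the torus ray `H(t g) = r^{[E:ℚ]} H(g)`, `N = 2`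
import Summits.HodgeConjecture.HodgeConjecture.Theorems.K2E1BLHeightCosetsU3                  -- ★ (K2E3-p12): `exists_torus_posRealIdele_three` — the same at `N = 3`
import HarnessLib

/-!
# h413 ∕ Track B «K2-LIT», campaign «5Res (b) BL-2(χ,τ)» — helper `K2E1ChiConstantTermColumnsIndependentU2` (dealer g7 (135)): THE COLUMNS `[φ′_j·H^{w}]` OF THE (χ,τ) CONSTANT-TERM
# FAMILY `L(z)` ARE LINEARLY INDEPENDENT IN `𝓗_k(Z_c)` — the payer of row 12b∕X1_χ's letter `hLinj : ∀ z ∈ ball 0 (n+2), σ₀ < Re z → Injective (L z)`; every rank, CM prints `N = 2, 3`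

Cell `pub/hodgecm-mathlib`, crux h413 = `stmt-HodgeConjecture-24833`, route of record `HCCMUnconditional`; dealer K2E1-plan (g7) (135); letter bytes ★ 12b p859726
`K2E1ChiEisensteinMeromorphicBallU2` :84 (`hLinj`), named by K2E1-p14 (g0) 11:27:36Z for X1_χ.  THEOREMS ONLY (no `def`, no `instance`, no notation, no named-fact hypothesis, no `sorry`);
lane `--supports stmt-HodgeConjecture-24833 --as helper` (count-neutral).  Closes no socket.  Rank-generic `(F, E, c, N)` in §1–§4; §5 is the CM print at `N = 2` and `N = 3`.

THE MATHEMATICS (Bernstein–Lapid §4 Claim 2 — non-degeneracy of the constant-term unknown, at `(χ, τ)`).  In coordinates `B = ℂ^ι`, `L(z) = Σ_j proj_j.smulRight (α_j(z))` is injective iff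
the `α_j(z) ∈ 𝓗_k(Z_c)` are linearly independent (★ 11b), where `α_j(z) =ᵐ zFun (f^{φ′_j}_{w}) = zFun φ′_j · HZ^{w}` on `Z_c` (★ K2E1-p15 `zFun_flatSectionU`; `w = 1 − z` at `N = 2`)
for a basis `φ′_j` of `V′`.  A relation `Σ_j c_j α_j(z) = 0` in `𝓗_k(Z_c) = L²(HZ^{−2k} μZ|_{Z_c})` says `zFun(Σ_j c_j φ′_j)·HZ^{w} = 0` `μZ`-a.e. on `Z_c` (§1), so (`HZ^{w} ≠ 0`) `zFun φ = 0`
a.e. on `Z_c`, `φ := Σ_j c_j φ′_j` a CONTINUOUS `χ`-section.  §2 DETECTION: in the comparison frame `∫⁻_Z f dμZ = ∫⁻_G β·(f∘π) dν_G` (`β` a covering weight of `B(F)♯`, `ν_G` left-invariant,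
positive on opens) the open `B(F)♯`-stable `S = {c < H} ∩ {φ ≠ 0}` has `β·1_S = 0` `ν_G`-a.e.; as `Σ_γ β(γ g) = 1`, every `g ∈ S` lies in some `γ⁻¹·(S ∩ {β ≠ 0})` (`γ ∈ B(F)♯`,
countable), so `ν_G(S) = 0`, so `S = ∅`.  §3 HEIGHT RAISING: `φ(b g) = χ(b₀₀) φ(g)` (`χ(b₀₀) ≠ 0`) and the torus ray `H(t_r g) = r^{[E:ℚ]} H(g)` (★ `exists_torus_posRealIdele_two∕three`)
push every `g` above height `c`, so `φ ≡ 0`, so `c_j = 0` by independence of the `φ′_j`.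

* §1 ALGEBRA IN `𝓗_k(Z_c)`: `zFun_sum_smul`, `coeFn_sum_smul_ae_eq`, **`linearIndependent_of_ae_eq_zFun_mul`** (on the detection letter `hdet`).  §2 DETECTION ON `G(𝔸)`:
  `measure_eq_zero_of_lintegral_coveringWeight_indicator_eq_zero`, **`forall_eq_zero_of_ae_zFun_eq_zero`**.  §3 `χ`-SECTIONS: `ratBorel_mul_of_isChiSection`, `isChiSection_sum_smul`,
  `continuous_sum_smul`, `eq_zero_of_isChiSection_of_forall_lt_borelHeight`, `exists_borelAdelic_lt_borelHeight_mul_two ∕ _three`, **`eq_zero_of_ae_zFun_sum_smul_eq_zero`** (`hdet` paid).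
* §4 HEADS (every rank): **`linearIndependent_of_ae_eq_zFun_flatSectionU`**, **`injective_sum_proj_smulRight_of_ae_eq_zFun_flatSectionU`**.  §5 CM PRINTS in `hLinj` bytes: **`hLinj_cm_two`**,
  **`hLinj_cm_three`** (any exponent map `w`; `w z = 1 − z` at `N = 2` is ★ K2E1-p15's `_one_sub` currency — pass `(fun z => 1 - z)`).

HONEST LABEL: HC_CM is proved only modulo the 7 printed citations (2 remaining named inputs: hLiu418 = `stmt-HodgeConjecture-24832`, h413 = `stmt-HodgeConjecture-24833`) until rung 0
closes; this file asserts no named fact and closes no socket.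
References: [BernsteinLapid2019] J. Bernstein, E. Lapid, *On the meromorphic continuation of Eisenstein series*, arXiv:1911.02342 (JAMS 37 (2024)), §4 Claim 2 (p. 9), p. 10;
[MoeglinWaldspurger1995] C. Mœglin, J.-L. Waldspurger, *Spectral Decomposition and Eisenstein Series*, I.2.1, I.2.17, II.1.5, II.1.7; [Borel1963] A. Borel, *Some finiteness properties of adele
groups over number fields*, §5; [WeilIntegration1965] A. Weil, *L'intégration dans les groupes topologiques*, §9; [Folland1999] G. B. Folland, *Real Analysis*, Thm. 2.14, §11.1.
-/

set_option autoImplicit false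
-- the mandated namespace repeats `HodgeConjecture.HodgeConjecture`, as in every `Theorems/*.lean` of this sub-problem
set_option linter.dupNamespace false

noncomputable section

open MeasureTheory MeasureTheory.Measure Set NumberField IsDedekindDomain Filter Topology Metric
open scoped NNReal ENNReal
open Literature.MeasureTheory.Group Literature.NumberTheory.Automorphic Literature.NumberTheory.Automorphic.UnitaryGroup AdelicGroupData
open Literature.NumberTheory.GaloisRepresentations (HeckeCharacter)
open Summit.HodgeConjecture.HodgeConjecture.Cruxes.H413.K2E1BorelEisensteinU
open Summit.HodgeConjecture.HodgeConjecture.Cruxes.H413.K2E1BLBorelSpacesU2Defs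
open Summit.HodgeConjecture.HodgeConjecture.Cruxes.H413.K2E1CharacterEisensteinU2Defs (IsChiSection firstEntryUnit)
open Summit.HodgeConjecture.HodgeConjecture.Cruxes.H413.K2E1BLIotaUnfoldingU (mem_ratBorelSubgroup_of_mem_map toBorelQuotient_mul_of_mem_map discreteTopology_map_arithmeticBorel continuous_borelQuotHeight)
open Summit.HodgeConjecture.HodgeConjecture.Cruxes.H413.K2E1BLShiftBoundU2 (ae_weightedTruncMeasure_iff)
open Summit.HodgeConjecture.HodgeConjecture.Cruxes.H413.K2E1BLHeightPowerHolomorphicU2 (borelQuotHeight_pos)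
open Summit.HodgeConjecture.HodgeConjecture.Cruxes.H413.K2E1BLInvariantSigmaDescentU (measurable_zFun_of_measurable)
open Summit.HodgeConjecture.HodgeConjecture.Cruxes.H413.K2E1ChiFlatSectionHNHolomorphicU2 (zFun_flatSectionU)
open Summit.HodgeConjecture.HodgeConjecture.Cruxes.H413.K2E1BorelCosetsDictionary (forall_arithmeticBorel_iff)
open Summit.HodgeConjecture.HodgeConjecture.Cruxes.H413.K2E1BLXSystemPackageFinDimU (injective_sum_proj_smulRight_iff)

namespace Summit.HodgeConjecture.HodgeConjecture.Cruxes.H413.K2E1ChiConstantTermColumnsIndependentU2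

section Generic

variable {F E : Type} [Field F] [NumberField F] [Field E] [NumberField E] [Algebra F E] {c : E ≃ₐ[F] E} {N : ℕ} [NeZero N]

/-! ## §1 Algebra in `𝓗_k(Z_c) = L²(HZ^{−2k}·μZ|_{Z_c})`: a relation among the columns is an a.e. relation among the `zFun φ′_j` -/

omit [NeZero N] in
/-- `zFun` of a finite linear combination, pointwise (`zFun` is evaluation at a representative). [cite: BernsteinLapid2019, §4 p. 10] -/
theorem zFun_sum_smul {ι' : Type*} (s : Finset ι') (cj : ι' → ℂ) (φ' : ι' → (quasiSplit F E c N).Adelic → ℂ) :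
    zFun F E c N (∑ j ∈ s, cj j • φ' j) = fun x => ∑ j ∈ s, cj j * zFun F E c N (φ' j) x := by
  funext x
  simp only [zFun, Finset.sum_apply, Pi.smul_apply, smul_eq_mul]

variable {k : ℕ} {c₁ : ℝ≥0} {μZ : Measure (borelQuotient F E c N)}

/-- The a.e. representative of a finite linear combination in `𝓗_k(Z_c)` is the linear combination of the representatives. [cite: Folland1999, §6.1] -/
theorem coeFn_sum_smul_ae_eq {ι' : Type*} (s : Finset ι') (cj : ι' → ℂ) (α : ι' → HN F E c N k c₁ μZ) :
    ((∑ j ∈ s, cj j • α j : HN F E c N k c₁ μZ) : borelQuotient F E c N → ℂ) =ᵐ[weightedTruncMeasure F E c N k c₁ μZ]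
      fun x => ∑ j ∈ s, cj j * (α j : borelQuotient F E c N → ℂ) x := by
  classical
  induction s using Finset.induction_on with
  | empty =>
    rw [Finset.sum_empty]
    filter_upwards [Lp.coeFn_zero (E := ℂ) (p := 2) (μ := weightedTruncMeasure F E c N k c₁ μZ)] with x hx
    rw [hx, Pi.zero_apply, Finset.sum_empty]
  | insert j s hj ih =>
    rw [Finset.sum_insert hj]
    filter_upwards [ih, Lp.coeFn_add (cj j • α j) (∑ i ∈ s, cj i • α i), Lp.coeFn_smul (cj j) (α j)] with x hx hadd hsmul
    rw [hadd, Pi.add_apply, hsmul, Pi.smul_apply, smul_eq_mul, hx, Finset.sum_insert hj]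

/-- **A RELATION AMONG THE COLUMNS IS AN A.E. RELATION AMONG THE `zFun φ′_j`** — hence LINEAR INDEPENDENCE ON THE DETECTION LETTER: if `α_j =ᵐ zFun φ′_j · ρ` on `Z_c` with `ρ ≠ 0`
pointwise (e.g. `ρ = HZ^{w}`), and the only linear combination `Σ_j c_j φ′_j` whose `zFun` vanishes `μZ`-a.e. on `Z_c` is the trivial one (`hdet`, paid in §3), then the `α_j` are linearly
independent in `𝓗_k(Z_c)`. [cite: BernsteinLapid2019, §4 Claim 2 (p. 9)] -/
theorem linearIndependent_of_ae_eq_zFun_mul {ι' : Type*} [Fintype ι'] {φ' : ι' → (quasiSplit F E c N).Adelic → ℂ} {ρ : borelQuotient F E c N → ℂ} (hρ : ∀ x, ρ x ≠ 0)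
    {α : ι' → HN F E c N k c₁ μZ} (hα : ∀ j, (α j : borelQuotient F E c N → ℂ) =ᵐ[weightedTruncMeasure F E c N k c₁ μZ] fun x => zFun F E c N (φ' j) x * ρ x)
    (hdet : ∀ cj : ι' → ℂ, (∀ᵐ x ∂(μZ.restrict {x | c₁ < borelQuotHeight F E c N x}), zFun F E c N (∑ j, cj j • φ' j) x = 0) → cj = 0) :
    LinearIndependent ℂ α := by
  refine Fintype.linearIndependent_iff.2 fun cj hcj j => ?_
  have hzero : ∀ᵐ x ∂(weightedTruncMeasure F E c N k c₁ μZ), zFun F E c N (∑ j, cj j • φ' j) x = 0 := by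
    have h0 : ((∑ j, cj j • α j : HN F E c N k c₁ μZ) : borelQuotient F E c N → ℂ) =ᵐ[weightedTruncMeasure F E c N k c₁ μZ] 0 := by
      rw [hcj]; exact Lp.coeFn_zero (E := ℂ) (p := 2) (μ := weightedTruncMeasure F E c N k c₁ μZ)
    filter_upwards [h0, coeFn_sum_smul_ae_eq Finset.univ cj α, ae_all_iff.2 hα] with x hx0 hxs hxα
    have hz : zFun F E c N (∑ j, cj j • φ' j) x = ∑ j, cj j * zFun F E c N (φ' j) x := congrFun (zFun_sum_smul Finset.univ cj φ') x
    rw [hz]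
    have h1 : (∑ j, cj j * zFun F E c N (φ' j) x) * ρ x = 0 := by
      calc (∑ j, cj j * zFun F E c N (φ' j) x) * ρ x = ∑ j, cj j * (α j : borelQuotient F E c N → ℂ) x := by
            rw [Finset.sum_mul]; exact Finset.sum_congr rfl fun j _ => by rw [hxα j, mul_assoc]
        _ = 0 := by rw [← hxs, hx0, Pi.zero_apply]
    exact (mul_eq_zero.1 h1).resolve_right (hρ x)
  have := hdet cj ((ae_weightedTruncMeasure_iff μZ k c₁).1 hzero)
  rw [this, Pi.zero_apply]

end Generic

/-! ## §2 Detection on `G(𝔸)`: a continuous left-`B(F)`-invariant function whose descent vanishes a.e. on `Z_c` vanishes on `{c < H}` -/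

section Detection

variable {F E : Type} [Field F] [NumberField F] [Field E] [NumberField E] [Algebra F E] {c : E ≃ₐ[F] E} {N : ℕ}
  [MeasurableSpace (quasiSplit F E c N).Adelic] [BorelSpace (quasiSplit F E c N).Adelic]

/-- **A `B(F)♯`-STABLE BOREL SET `S` WITH `∫⁻ β·1_S dν_G = 0` IS `ν_G`-NULL** (`β` a covering weight of `B(F)♯`, `ν_G` left-invariant): `β·1_S = 0` a.e., and every `g ∈ S` has some `γ ∈ B(F)♯`
with `β(γ g) ≠ 0` (`Σ_γ β(γ g) = 1`), i.e. `S ⊆ ⋃_γ γ⁻¹·(S ∩ {β ≠ 0})` — countably many (`B(F)♯` discrete, `G(𝔸)` second countable) null translates. [cite: WeilIntegration1965, §9] [cite: Borel1963, §5] -/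
theorem measure_eq_zero_of_lintegral_coveringWeight_indicator_eq_zero (νG : Measure (quasiSplit F E c N).Adelic) [νG.IsMulLeftInvariant]
    {β : (quasiSplit F E c N).Adelic → ℝ≥0∞} (hβ : IsCoveringWeight ↥((arithmeticBorel F E c N).map (quasiSplit F E c N).arithmeticSubgroup.subtype) β)
    {S : Set (quasiSplit F E c N).Adelic} (hSm : MeasurableSet S)
    (hSinv : ∀ γ ∈ (arithmeticBorel F E c N).map (quasiSplit F E c N).arithmeticSubgroup.subtype, ∀ g ∈ S, γ * g ∈ S)
    (h0 : ∫⁻ g, β g * S.indicator 1 g ∂νG = 0) : νG S = 0 := by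
  classical
  haveI := t2Space_adeleRing_of_numberField E
  haveI := locallyCompactSpace_adeleRing' E
  haveI := secondCountableTopology_adeleRing E
  haveI : SecondCountableTopology (quasiSplit F E c N).Adelic := inferInstanceAs (SecondCountableTopology (adelic F E c N ((StdForm.antidiagonal N).over E)))
  haveI := discreteTopology_map_arithmeticBorel (F := F) (E := E) (c := c) (N := N)
  set Γ : Subgroup (quasiSplit F E c N).Adelic := (arithmeticBorel F E c N).map (quasiSplit F E c N).arithmeticSubgroup.subtype with hΓ
  haveI : Countable Γ := by
    haveI : SecondCountableTopology Γ := TopologicalSpace.Subtype.secondCountableTopology _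
    exact countable_of_Lindelof_of_discrete
  have hmeas : Measurable fun g => β g * S.indicator 1 g := hβ.measurable.mul (measurable_one.indicator hSm)
  have hA : νG {g | β g * S.indicator 1 g ≠ 0} = 0 := by
    have hae : (fun g => β g * S.indicator 1 g) =ᵐ[νG] 0 := (lintegral_eq_zero_iff hmeas).1 h0
    exact ae_iff.1 hae
  have hsub : S ⊆ ⋃ γ : Γ, (fun g => (γ : (quasiSplit F E c N).Adelic) * g) ⁻¹' {g | β g * S.indicator 1 g ≠ 0} := by
    intro g hg
    have h1 : ∑' γ : Γ, β (γ • g) = 1 := by rw [← coveringSum_apply]; exact hβ.coveringSum_eq g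
    by_contra hnot
    simp only [mem_iUnion, mem_preimage, mem_setOf_eq, not_exists, not_not] at hnot
    have hz : ∑' γ : Γ, β (γ • g) = 0 := ENNReal.tsum_eq_zero.2 fun γ => by
      have h2 := hnot γ
      rwa [indicator_of_mem (hSinv γ γ.2 g hg), Pi.one_apply, mul_one] at h2
    rw [hz] at h1
    exact zero_ne_one h1
  refine measure_mono_null hsub (measure_iUnion_null fun γ => ?_)
  rw [measure_preimage_mul]
  exact hA

variable [NeZero N]

/-- **DETECTION**: in the comparison frame `∫⁻_Z f dμZ = ∫⁻_G β·(f∘π) dν_G` (`β` a covering weight of `B(F)♯`, `ν_G` left-invariant and positive on opens), a CONTINUOUS left-`B(F)`-invariant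
`φ : G(𝔸) → ℂ` whose descent `zFun φ` vanishes `μZ`-a.e. on `Z_c = {c < HZ}` vanishes at every `g` with `c < H(g)`: the open `B(F)♯`-stable set `S = {c < H} ∩ {φ ≠ 0}` is `ν_G`-null
(`measure_eq_zero_of_lintegral_coveringWeight_indicator_eq_zero`), hence empty. [cite: BernsteinLapid2019, §4 p. 10] [cite: WeilIntegration1965, §9] -/
theorem forall_eq_zero_of_ae_zFun_eq_zero (νG : Measure (quasiSplit F E c N).Adelic) [νG.IsMulLeftInvariant] [νG.IsOpenPosMeasure]
    {β : (quasiSplit F E c N).Adelic → ℝ≥0∞} (hβ : IsCoveringWeight ↥((arithmeticBorel F E c N).map (quasiSplit F E c N).arithmeticSubgroup.subtype) β)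
    {μZ : Measure (borelQuotient F E c N)}
    (hμZ : ∀ f : borelQuotient F E c N → ℝ≥0∞, Measurable f → ∫⁻ z, f z ∂μZ = ∫⁻ g, β g * f (toBorelQuotient F E c N g) ∂νG)
    {φ : (quasiSplit F E c N).Adelic → ℂ} (hφc : Continuous φ) (hφB : ∀ γ ∈ ratBorelSubgroup F E c N, ∀ g, φ (γ * g) = φ g) {c₁ : ℝ≥0}
    (h0 : ∀ᵐ x ∂(μZ.restrict {x | c₁ < borelQuotHeight F E c N x}), zFun F E c N φ x = 0) :
    ∀ g : (quasiSplit F E c N).Adelic, c₁ < borelHeight g → φ g = 0 := by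
  -- the open set `S ⊆ G` and its Borel shadow `T ⊆ Z`
  have hSo : IsOpen {g : (quasiSplit F E c N).Adelic | c₁ < borelHeight g ∧ φ g ≠ 0} := (isOpen_setOf_lt_borelHeight c₁).inter (isOpen_ne_fun hφc continuous_const)
  have hTm : MeasurableSet {x : borelQuotient F E c N | c₁ < borelQuotHeight F E c N x ∧ zFun F E c N φ x ≠ 0} :=
    (isOpen_lt continuous_const continuous_borelQuotHeight).measurableSet.inter ((measurable_zFun_of_measurable hφc.measurable hφB) (measurableSet_singleton (0 : ℂ)).compl)
  -- `μZ T = 0`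
  have hT0 : μZ {x : borelQuotient F E c N | c₁ < borelQuotHeight F E c N x ∧ zFun F E c N φ x ≠ 0} = 0 := by
    have h0' := (ae_restrict_iff' (isOpen_lt continuous_const continuous_borelQuotHeight).measurableSet).1 h0
    exact measure_eq_zero_iff_ae_notMem.2 (h0'.mono fun x hx hxT => hxT.2 (hx hxT.1))
  -- transported to `G`: `∫⁻ β·1_S dν_G = 0`
  have hpre : ∀ g : (quasiSplit F E c N).Adelic, toBorelQuotient F E c N g ∈ {x : borelQuotient F E c N | c₁ < borelQuotHeight F E c N x ∧ zFun F E c N φ x ≠ 0} ↔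
      g ∈ {g : (quasiSplit F E c N).Adelic | c₁ < borelHeight g ∧ φ g ≠ 0} := fun g => by
    simp only [mem_setOf_eq, borelQuotHeight_toBorelQuotient, zFun_toBorelQuotient F E c N hφB]
  have hind : ∀ g : (quasiSplit F E c N).Adelic,
      {x : borelQuotient F E c N | c₁ < borelQuotHeight F E c N x ∧ zFun F E c N φ x ≠ 0}.indicator (1 : borelQuotient F E c N → ℝ≥0∞) (toBorelQuotient F E c N g) =
        {g : (quasiSplit F E c N).Adelic | c₁ < borelHeight g ∧ φ g ≠ 0}.indicator 1 g := fun g => by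
    by_cases hg : g ∈ {g : (quasiSplit F E c N).Adelic | c₁ < borelHeight g ∧ φ g ≠ 0}
    · rw [indicator_of_mem hg, indicator_of_mem ((hpre g).2 hg), Pi.one_apply, Pi.one_apply]
    · rw [indicator_of_notMem hg, indicator_of_notMem fun h => hg ((hpre g).1 h)]
  have h1 : ∫⁻ g, β g * {g : (quasiSplit F E c N).Adelic | c₁ < borelHeight g ∧ φ g ≠ 0}.indicator 1 g ∂νG = 0 := by
    have h2 := hμZ _ (measurable_one.indicator hTm)
    rw [lintegral_indicator_one hTm, hT0] at h2
    simp only [hind] at h2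
    exact h2.symm
  -- `S` is `B(F)♯`-stable, hence null, hence empty
  have hSinv : ∀ γ ∈ (arithmeticBorel F E c N).map (quasiSplit F E c N).arithmeticSubgroup.subtype, ∀ g ∈ {g : (quasiSplit F E c N).Adelic | c₁ < borelHeight g ∧ φ g ≠ 0},
      γ * g ∈ {g : (quasiSplit F E c N).Adelic | c₁ < borelHeight g ∧ φ g ≠ 0} := fun γ hγ g hg => by
    refine ⟨?_, by rw [hφB γ (mem_ratBorelSubgroup_of_mem_map hγ) g]; exact hg.2⟩
    rw [← borelQuotHeight_toBorelQuotient F E c N (γ * g), toBorelQuotient_mul_of_mem_map hγ, borelQuotHeight_toBorelQuotient]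
    exact hg.1
  have hS0 := measure_eq_zero_of_lintegral_coveringWeight_indicator_eq_zero νG hβ hSo.measurableSet hSinv h1
  have hSe := (hSo.measure_eq_zero_iff νG).1 hS0
  intro g hg
  by_contra hφg
  have hmem : g ∈ {g : (quasiSplit F E c N).Adelic | c₁ < borelHeight g ∧ φ g ≠ 0} := ⟨hg, hφg⟩
  rw [hSe] at hmem
  exact hmem

end Detection

/-! ## §3 `χ`-sections: left-`B(F)`-invariance, finite sums, height raising along the torus, and the detection letter paid -/

section ChiSections

variable {F E : Type} [Field F] [NumberField F] [Field E] [NumberField E] [Algebra F E] {c : E ≃ₐ[F] E} {N : ℕ} [NeZero N] {χ : HeckeCharacter E}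

/-- A `χ`-section is left-`B(F)`-invariant in the `ratBorelSubgroup` spelling of the BL leaf (★ `IsChiSection.toAdelic_mul` through ★ `forall_arithmeticBorel_iff`). [cite: MoeglinWaldspurger1995, II.1.5] -/
theorem ratBorel_mul_of_isChiSection {φ : (quasiSplit F E c N).Adelic → ℂ} (hφ : IsChiSection χ φ) :
    ∀ γ ∈ ratBorelSubgroup F E c N, ∀ g : (quasiSplit F E c N).Adelic, φ (γ * g) = φ g := fun γ hγ g =>
  (forall_arithmeticBorel_iff.2 hφ.toAdelic_mul) ⟨γ, ratBorelSubgroup_le_arithmeticSubgroup F E c N hγ⟩ ((mem_arithmeticBorel_iff _).2 hγ.1) g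

/-- Finite linear combinations of `χ`-sections are `χ`-sections. [folklore] -/
theorem isChiSection_sum_smul {ι' : Type*} (s : Finset ι') (cj : ι' → ℂ) {φ' : ι' → (quasiSplit F E c N).Adelic → ℂ} (hφχ : ∀ j, IsChiSection χ (φ' j)) :
    IsChiSection χ (∑ j ∈ s, cj j • φ' j) :=
  Finset.sum_induction _ (fun ψ => IsChiSection χ ψ) (fun _ _ ha hb => ha.add hb) (IsChiSection.zero χ) fun j _ => (hφχ j).smul (cj j)

omit [NeZero N] in
/-- Finite linear combinations of continuous functions on `G(𝔸)` are continuous. [folklore] -/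
theorem continuous_sum_smul {ι' : Type*} (s : Finset ι') (cj : ι' → ℂ) {φ' : ι' → (quasiSplit F E c N).Adelic → ℂ} (hφc : ∀ j, Continuous (φ' j)) :
    Continuous (∑ j ∈ s, cj j • φ' j) := by
  have h : (∑ j ∈ s, cj j • φ' j) = fun g => ∑ j ∈ s, cj j * φ' j g := by
    funext g; simp only [Finset.sum_apply, Pi.smul_apply, smul_eq_mul]
  rw [h]
  exact continuous_finsetSum s fun j _ => continuous_const.mul (hφc j)

/-- **HEIGHT RAISING**: a `χ`-section vanishing on `{c < H}` vanishes identically, provided every point can be pushed above height `c` by an element of `B(𝔸)` (`hraise` — the torus ray,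
`exists_borelAdelic_lt_borelHeight_mul_two∕_three`): `φ(b g) = χ(b₀₀)·φ(g)` with `χ(b₀₀) ≠ 0`. [cite: MoeglinWaldspurger1995, I.2.17] [cite: BernsteinLapid2019, §4 Claim 2 (p. 9)] -/
theorem eq_zero_of_isChiSection_of_forall_lt_borelHeight {φ : (quasiSplit F E c N).Adelic → ℂ} (hφ : IsChiSection χ φ) {c₁ : ℝ≥0}
    (hraise : ∀ g : (quasiSplit F E c N).Adelic, ∃ b ∈ borelAdelic F E c N, c₁ < borelHeight (b * g)) (h : ∀ g : (quasiSplit F E c N).Adelic, c₁ < borelHeight g → φ g = 0) :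
    φ = 0 := by
  funext g
  obtain ⟨b, hb, hlt⟩ := hraise g
  have h1 := h (b * g) hlt
  rw [hφ.borel_mul hb g] at h1
  exact (mul_eq_zero.1 h1).resolve_left (Units.ne_zero _)

/-- From the torus ray `H(t_r g) = r^{[E:ℚ]}·H(g)`: for every `g` and `c` some `r` gives `c < H(t_r g)`. [cite: Borel1963, §5] -/
theorem lt_pow_mul_borelHeight (c₁ : ℝ≥0) (g : (quasiSplit F E c N).Adelic) :
    c₁ < max 1 ((c₁ + 1) / borelHeight g) ^ Module.finrank ℚ E * borelHeight g := by
  have hH : 0 < borelHeight g := borelHeight_pos g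
  calc c₁ < c₁ + 1 := lt_add_one c₁
    _ = (c₁ + 1) / borelHeight g * borelHeight g := (div_mul_cancel₀ _ hH.ne').symm
    _ ≤ max 1 ((c₁ + 1) / borelHeight g) * borelHeight g := by gcongr; exact le_max_right _ _
    _ ≤ max 1 ((c₁ + 1) / borelHeight g) ^ Module.finrank ℚ E * borelHeight g := by
        gcongr; exact le_self_pow (le_max_left _ _) Module.finrank_pos.ne'

end ChiSections

section Raise

variable {F E : Type} [Field F] [NumberField F] [Field E] [NumberField E] [Algebra F E] {c : E ≃ₐ[F] E}

/-- **`hraise` AT `N = 2`** (`c² = 1`): every `g ∈ U(J₂)(𝔸_F)` is pushed above any height by a torus element (★ `exists_torus_posRealIdele_two`). [cite: Borel1963, §5] [cite: Rogawski1990, §2.2] -/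
theorem exists_borelAdelic_lt_borelHeight_mul_two (hc : c * c = 1) (c₁ : ℝ≥0) (g : (quasiSplit F E c 2).Adelic) : ∃ b ∈ borelAdelic F E c 2, c₁ < borelHeight (b * g) := by
  have hr : (max 1 ((c₁ + 1) / borelHeight g) : ℝ≥0) ≠ 0 := (lt_of_lt_of_le one_pos (le_max_left _ _)).ne'
  obtain ⟨t, -, -, hH⟩ := K2E1BLHeightCosetsU2.exists_torus_posRealIdele_two (F := F) (E := E) (c := c) hc (Units.mk0 _ hr)
  refine ⟨((t : borelAdelic F E c 2) : (quasiSplit F E c 2).Adelic), (t : borelAdelic F E c 2).2, ?_⟩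
  rw [hH g, Units.val_mk0]
  exact lt_pow_mul_borelHeight c₁ g

/-- **`hraise` AT `N = 3`**: every `g ∈ U(J₃)(𝔸_F)` is pushed above any height by a torus element (★ `exists_torus_posRealIdele_three`). [cite: Borel1963, §5] [cite: Rogawski1990, §2.2] -/
theorem exists_borelAdelic_lt_borelHeight_mul_three (c₁ : ℝ≥0) (g : (quasiSplit F E c 3).Adelic) : ∃ b ∈ borelAdelic F E c 3, c₁ < borelHeight (b * g) := by
  have hr : (max 1 ((c₁ + 1) / borelHeight g) : ℝ≥0) ≠ 0 := (lt_of_lt_of_le one_pos (le_max_left _ _)).ne'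
  obtain ⟨t, -, hH⟩ := K2E1BLHeightCosetsU3.exists_torus_posRealIdele_three (F := F) (E := E) (c := c) (Units.mk0 _ hr)
  refine ⟨((t : borelAdelic F E c 3) : (quasiSplit F E c 3).Adelic), (t : borelAdelic F E c 3).2, ?_⟩
  rw [hH g, Units.val_mk0]
  exact lt_pow_mul_borelHeight c₁ g

end Raise

section Paid

variable {F E : Type} [Field F] [NumberField F] [Field E] [NumberField E] [Algebra F E] {c : E ≃ₐ[F] E} {N : ℕ} [NeZero N]
  [MeasurableSpace (quasiSplit F E c N).Adelic] [BorelSpace (quasiSplit F E c N).Adelic] {χ : HeckeCharacter E}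

/-- **THE DETECTION LETTER `hdet` PAID**: for linearly independent CONTINUOUS `χ`-sections `φ′_j`, in the comparison frame `(ν_G, β, μZ)` with `ν_G` left-invariant and positive on opens and
with height raising available (`hraise`), a linear combination `Σ_j c_j φ′_j` whose descent vanishes `μZ`-a.e. on `Z_c` is trivial: §2 detection on `{c < H}`, §3 height raising, independence.
[cite: BernsteinLapid2019, §4 Claim 2 (p. 9)] [cite: MoeglinWaldspurger1995, I.2.17] -/
theorem eq_zero_of_ae_zFun_sum_smul_eq_zero (νG : Measure (quasiSplit F E c N).Adelic) [νG.IsMulLeftInvariant] [νG.IsOpenPosMeasure]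
    {β : (quasiSplit F E c N).Adelic → ℝ≥0∞} (hβ : IsCoveringWeight ↥((arithmeticBorel F E c N).map (quasiSplit F E c N).arithmeticSubgroup.subtype) β)
    {μZ : Measure (borelQuotient F E c N)}
    (hμZ : ∀ f : borelQuotient F E c N → ℝ≥0∞, Measurable f → ∫⁻ z, f z ∂μZ = ∫⁻ g, β g * f (toBorelQuotient F E c N g) ∂νG)
    {ι' : Type*} [Fintype ι'] {φ' : ι' → (quasiSplit F E c N).Adelic → ℂ} (hli : LinearIndependent ℂ φ') (hφc : ∀ j, Continuous (φ' j)) (hφχ : ∀ j, IsChiSection χ (φ' j))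
    {c₁ : ℝ≥0} (hraise : ∀ g : (quasiSplit F E c N).Adelic, ∃ b ∈ borelAdelic F E c N, c₁ < borelHeight (b * g)) {cj : ι' → ℂ}
    (h0 : ∀ᵐ x ∂(μZ.restrict {x | c₁ < borelQuotHeight F E c N x}), zFun F E c N (∑ j, cj j • φ' j) x = 0) : cj = 0 := by
  have hχ : IsChiSection χ (∑ j, cj j • φ' j) := isChiSection_sum_smul Finset.univ cj hφχ
  have hzero := forall_eq_zero_of_ae_zFun_eq_zero νG hβ hμZ (continuous_sum_smul Finset.univ cj hφc) (ratBorel_mul_of_isChiSection hχ) h0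
  have hφ0 : ∑ j, cj j • φ' j = 0 := eq_zero_of_isChiSection_of_forall_lt_borelHeight hχ hraise hzero
  funext j
  exact Fintype.linearIndependent_iff.1 hli cj hφ0 j

/-! ## §4 The heads (every rank): linear independence of the columns `[φ′_j·H^{w}]` in `𝓗_k(Z_c)` and injectivity of `L = Σ_j proj_j.smulRight α_j` -/

/-- **THE COLUMNS `α_j =ᵐ zFun (f^{φ′_j}_{w}) = zFun φ′_j · HZ^{w}` ARE LINEARLY INDEPENDENT IN `𝓗_k(Z_c)`** for linearly independent continuous `χ`-sections `φ′_j` (comparison frame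
`(ν_G, β, μZ)`, height raising `hraise`): §1 on the §3-paid detection letter, with `ρ = HZ^{w} ≠ 0`. [cite: BernsteinLapid2019, §4 Claim 2 (p. 9)] [cite: MoeglinWaldspurger1995, II.1.7] -/
theorem linearIndependent_of_ae_eq_zFun_flatSectionU (νG : Measure (quasiSplit F E c N).Adelic) [νG.IsMulLeftInvariant] [νG.IsOpenPosMeasure]
    {β : (quasiSplit F E c N).Adelic → ℝ≥0∞} (hβ : IsCoveringWeight ↥((arithmeticBorel F E c N).map (quasiSplit F E c N).arithmeticSubgroup.subtype) β)
    {μZ : Measure (borelQuotient F E c N)}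
    (hμZ : ∀ f : borelQuotient F E c N → ℝ≥0∞, Measurable f → ∫⁻ z, f z ∂μZ = ∫⁻ g, β g * f (toBorelQuotient F E c N g) ∂νG)
    {ι' : Type*} [Fintype ι'] {φ' : ι' → (quasiSplit F E c N).Adelic → ℂ} (hli : LinearIndependent ℂ φ') (hφc : ∀ j, Continuous (φ' j)) (hφχ : ∀ j, IsChiSection χ (φ' j))
    {k : ℕ} {c₁ : ℝ≥0} (hraise : ∀ g : (quasiSplit F E c N).Adelic, ∃ b ∈ borelAdelic F E c N, c₁ < borelHeight (b * g))
    {α : ι' → HN F E c N k c₁ μZ} {w : ℂ} (hα : ∀ j, (α j : borelQuotient F E c N → ℂ) =ᵐ[weightedTruncMeasure F E c N k c₁ μZ] zFun F E c N (flatSectionU (φ' j) w)) :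
    LinearIndependent ℂ α := by
  refine linearIndependent_of_ae_eq_zFun_mul (φ' := φ') (ρ := fun x => (((borelQuotHeight F E c N x : ℝ≥0) : ℝ) : ℂ) ^ w) (fun x h => ?_) (fun j => ?_)
    fun cj h0 => eq_zero_of_ae_zFun_sum_smul_eq_zero νG hβ hμZ hli hφc hφχ hraise h0
  · exact (NNReal.coe_pos.2 (borelQuotHeight_pos x)).ne' (Complex.ofReal_eq_zero.1 ((Complex.cpow_eq_zero_iff _ _).1 h).1)
  · show (α j : borelQuotient F E c N → ℂ) =ᵐ[weightedTruncMeasure F E c N k c₁ μZ] fun x => zFun F E c N (φ' j) x * (((borelQuotHeight F E c N x : ℝ≥0) : ℝ) : ℂ) ^ w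
    rw [← zFun_flatSectionU]; exact hα j

/-- **`L = Σ_j proj_j.smulRight α_j : ℂ^ι →L 𝓗_k(Z_c)` IS INJECTIVE** when `α_j =ᵐ zFun (f^{φ′_j}_{w})` for linearly independent continuous `χ`-sections `φ′_j` (★ 11b
`injective_sum_proj_smulRight_iff`) — the content of row 12b's letter `hLinj` at one point `z` (`w = ρ₀ − z`). [cite: BernsteinLapid2019, §4 Claim 2 (p. 9)] -/
theorem injective_sum_proj_smulRight_of_ae_eq_zFun_flatSectionU (νG : Measure (quasiSplit F E c N).Adelic) [νG.IsMulLeftInvariant] [νG.IsOpenPosMeasure]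
    {β : (quasiSplit F E c N).Adelic → ℝ≥0∞} (hβ : IsCoveringWeight ↥((arithmeticBorel F E c N).map (quasiSplit F E c N).arithmeticSubgroup.subtype) β)
    {μZ : Measure (borelQuotient F E c N)}
    (hμZ : ∀ f : borelQuotient F E c N → ℝ≥0∞, Measurable f → ∫⁻ z, f z ∂μZ = ∫⁻ g, β g * f (toBorelQuotient F E c N g) ∂νG)
    {ι' : Type*} [Fintype ι'] {φ' : ι' → (quasiSplit F E c N).Adelic → ℂ} (hli : LinearIndependent ℂ φ') (hφc : ∀ j, Continuous (φ' j)) (hφχ : ∀ j, IsChiSection χ (φ' j))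
    {k : ℕ} {c₁ : ℝ≥0} (hraise : ∀ g : (quasiSplit F E c N).Adelic, ∃ b ∈ borelAdelic F E c N, c₁ < borelHeight (b * g))
    {α : ι' → HN F E c N k c₁ μZ} {w : ℂ} (hα : ∀ j, (α j : borelQuotient F E c N → ℂ) =ᵐ[weightedTruncMeasure F E c N k c₁ μZ] zFun F E c N (flatSectionU (φ' j) w)) :
    Function.Injective ((∑ j, (ContinuousLinearMap.proj (R := ℂ) (φ := fun _ : ι' => ℂ) j).smulRight (α j) : (ι' → ℂ) →L[ℂ] HN F E c N k c₁ μZ) : (ι' → ℂ) → HN F E c N k c₁ μZ) :=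
  (injective_sum_proj_smulRight_iff (fun j (_ : ℂ) => α j) 0).2 (linearIndependent_of_ae_eq_zFun_flatSectionU νG hβ hμZ hli hφc hφχ hraise hα)

end Paid

/-! ## §5 The CM prints (`N = 2`, `N = 3`) in the bytes of row 12b's `hLinj` -/

section CM

variable (L : Type) [Field L] [NumberField L] [IsCMField L]

/-- **ROW 12b's `hLinj` FOR THE CM PAIR AT `N = 2`**: for a Haar measure `ν_G`, a covering weight `β` of `B(F)♯` with comparison `hμZ`, linearly independent continuous `χ`-sections `φ′_j`
(a basis of `V′ = V(χ, K′, ω′)` coerced to functions: `hli := bV.linearIndependent.map' V′.subtype V′.ker_subtype`, `hφχ j := isChiSection_of_mem (bV j).2`), and columns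
`α_j(z) =ᵐ zFun (f^{φ′_j}_{w(z)})` on `Z_a` along the Godement part of the ball, the coordinate family `L(z) = Σ_j proj_j.smulRight (α_j z)` is injective there — `hraise` discharged by the torus
ray (`c² = 1` for the CM involution). [cite: BernsteinLapid2019, §4 Claim 2 (p. 9)] [cite: MoeglinWaldspurger1995, II.1.7] -/
theorem hLinj_cm_two [MeasurableSpace (quasiSplit (↥(maximalRealSubfield L)) L (IsCMField.complexConj L) 2).Adelic] [BorelSpace (quasiSplit (↥(maximalRealSubfield L)) L (IsCMField.complexConj L) 2).Adelic] (νG : Measure (quasiSplit (↥(maximalRealSubfield L)) L (IsCMField.complexConj L) 2).Adelic) [νG.IsHaarMeasure]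
    {β : (quasiSplit (↥(maximalRealSubfield L)) L (IsCMField.complexConj L) 2).Adelic → ℝ≥0∞}
    (hβ : IsCoveringWeight ↥((arithmeticBorel (↥(maximalRealSubfield L)) L (IsCMField.complexConj L) 2).map
      (quasiSplit (↥(maximalRealSubfield L)) L (IsCMField.complexConj L) 2).arithmeticSubgroup.subtype) β)
    {μZ : Measure (borelQuotient (↥(maximalRealSubfield L)) L (IsCMField.complexConj L) 2)}
    (hμZ : ∀ f : borelQuotient (↥(maximalRealSubfield L)) L (IsCMField.complexConj L) 2 → ℝ≥0∞, Measurable f →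
      ∫⁻ z, f z ∂μZ = ∫⁻ g, β g * f (toBorelQuotient (↥(maximalRealSubfield L)) L (IsCMField.complexConj L) 2 g) ∂νG)
    {χ : HeckeCharacter L} {ι' : Type*} [Fintype ι'] {φ' : ι' → (quasiSplit (↥(maximalRealSubfield L)) L (IsCMField.complexConj L) 2).Adelic → ℂ}
    (hli : LinearIndependent ℂ φ') (hφc : ∀ j, Continuous (φ' j)) (hφχ : ∀ j, IsChiSection χ (φ' j)) (σ₀ : ℝ) (n k : ℕ) {a : ℝ≥0} (w : ℂ → ℂ)
    {α : ι' → ℂ → HN (↥(maximalRealSubfield L)) L (IsCMField.complexConj L) 2 k a μZ}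
    (hα : ∀ j, ∀ z ∈ ball (0 : ℂ) (n + 2), σ₀ < z.re → (α j z : borelQuotient (↥(maximalRealSubfield L)) L (IsCMField.complexConj L) 2 → ℂ)
      =ᵐ[weightedTruncMeasure (↥(maximalRealSubfield L)) L (IsCMField.complexConj L) 2 k a μZ] zFun (↥(maximalRealSubfield L)) L (IsCMField.complexConj L) 2 (flatSectionU (φ' j) (w z))) :
    ∀ z ∈ ball (0 : ℂ) (n + 2), σ₀ < z.re →
      Function.Injective ((∑ j, (ContinuousLinearMap.proj (R := ℂ) (φ := fun _ : ι' => ℂ) j).smulRight (α j z) :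
        (ι' → ℂ) →L[ℂ] HN (↥(maximalRealSubfield L)) L (IsCMField.complexConj L) 2 k a μZ) : (ι' → ℂ) → HN (↥(maximalRealSubfield L)) L (IsCMField.complexConj L) 2 k a μZ) :=
  have hc : IsCMField.complexConj L * IsCMField.complexConj L = 1 := AlgEquiv.ext fun x => IsCMField.complexConj_apply_apply L x
  fun z hz hσ => injective_sum_proj_smulRight_of_ae_eq_zFun_flatSectionU νG hβ hμZ hli hφc hφχ (exists_borelAdelic_lt_borelHeight_mul_two hc a) fun j => hα j z hz hσ

/-- **ROW 12b's `hLinj` FOR THE CM PAIR AT `N = 3`** (any exponent map `w`, e.g. `w z = 2 − z`): as `hLinj_cm_two`, `hraise` by the `N = 3` torus ray. [cite: BernsteinLapid2019, §4 Claim 2 (p. 9)]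
[cite: MoeglinWaldspurger1995, II.1.7] -/
theorem hLinj_cm_three [MeasurableSpace (quasiSplit (↥(maximalRealSubfield L)) L (IsCMField.complexConj L) 3).Adelic] [BorelSpace (quasiSplit (↥(maximalRealSubfield L)) L (IsCMField.complexConj L) 3).Adelic] (νG : Measure (quasiSplit (↥(maximalRealSubfield L)) L (IsCMField.complexConj L) 3).Adelic) [νG.IsHaarMeasure]
    {β : (quasiSplit (↥(maximalRealSubfield L)) L (IsCMField.complexConj L) 3).Adelic → ℝ≥0∞}
    (hβ : IsCoveringWeight ↥((arithmeticBorel (↥(maximalRealSubfield L)) L (IsCMField.complexConj L) 3).map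
      (quasiSplit (↥(maximalRealSubfield L)) L (IsCMField.complexConj L) 3).arithmeticSubgroup.subtype) β)
    {μZ : Measure (borelQuotient (↥(maximalRealSubfield L)) L (IsCMField.complexConj L) 3)}
    (hμZ : ∀ f : borelQuotient (↥(maximalRealSubfield L)) L (IsCMField.complexConj L) 3 → ℝ≥0∞, Measurable f →
      ∫⁻ z, f z ∂μZ = ∫⁻ g, β g * f (toBorelQuotient (↥(maximalRealSubfield L)) L (IsCMField.complexConj L) 3 g) ∂νG)
    {χ : HeckeCharacter L} {ι' : Type*} [Fintype ι'] {φ' : ι' → (quasiSplit (↥(maximalRealSubfield L)) L (IsCMField.complexConj L) 3).Adelic → ℂ}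
    (hli : LinearIndependent ℂ φ') (hφc : ∀ j, Continuous (φ' j)) (hφχ : ∀ j, IsChiSection χ (φ' j)) (σ₀ : ℝ) (n k : ℕ) {a : ℝ≥0} (w : ℂ → ℂ)
    {α : ι' → ℂ → HN (↥(maximalRealSubfield L)) L (IsCMField.complexConj L) 3 k a μZ}
    (hα : ∀ j, ∀ z ∈ ball (0 : ℂ) (n + 2), σ₀ < z.re → (α j z : borelQuotient (↥(maximalRealSubfield L)) L (IsCMField.complexConj L) 3 → ℂ)
      =ᵐ[weightedTruncMeasure (↥(maximalRealSubfield L)) L (IsCMField.complexConj L) 3 k a μZ] zFun (↥(maximalRealSubfield L)) L (IsCMField.complexConj L) 3 (flatSectionU (φ' j) (w z))) :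
    ∀ z ∈ ball (0 : ℂ) (n + 2), σ₀ < z.re →
      Function.Injective ((∑ j, (ContinuousLinearMap.proj (R := ℂ) (φ := fun _ : ι' => ℂ) j).smulRight (α j z) :
        (ι' → ℂ) →L[ℂ] HN (↥(maximalRealSubfield L)) L (IsCMField.complexConj L) 3 k a μZ) : (ι' → ℂ) → HN (↥(maximalRealSubfield L)) L (IsCMField.complexConj L) 3 k a μZ) :=
  fun z hz hσ => injective_sum_proj_smulRight_of_ae_eq_zFun_flatSectionU νG hβ hμZ hli hφc hφχ (exists_borelAdelic_lt_borelHeight_mul_three a) fun j => hα j z hz hσ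

end CM

end Summit.HodgeConjecture.HodgeConjecture.Cruxes.H413.K2E1ChiConstantTermColumnsIndependentU2

end
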